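import Literature.Computability.QuantumComplexity.BQPProofs
import Literature.Computability.Cryptography.QubitRegisterProofs
import HarnessLib

/-!
# Classical reversible gates as exact Clifford+T words: `X`, `CNOT`, Toffoli on basis states

Towards the named fact `Literature.Computability.QuantumComplexity.uniformReversibleSimulation` (the reversible core
of `BPP ⊆ BQP`, Bernstein–Vazirani 1997, Thm. 8.3; Arora–Barak 2009, Lemma 10.10 and
Cor. 10.11): the classical part of the simulating circuit family is a *reversible* circuit over
`{NOT, CNOT, Toffoli}` (Arora–Barak 2009, §10.3.7, Lemma 10.10: "replace each Boolean gate
(AND, OR, NOT) by its quantum analog"; Nielsen–Chuang 2010, §3.2.5), and `BQP` is built on the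
Clifford+T gate set `{H, S, T, CNOT}` (`Literature.Computability.Cryptography.cliffordT`). This file supplies
the exact (not approximate) Clifford+T words for these three classical gates together with
their action on computational basis states, and the resulting compiler from reversible
circuits to Clifford+T circuits with its classical semantics:

* placed gates `tOn`, `sOn`, `cnotOn` (and `hOn` from `BQPProofs`) with the basis-state
  formulas `tOn_mulVec_basisState` (`T|w⟩ = ω^{w_i}|w⟩`, `ω = e^{iπ/4}`),
  `sOn_mulVec_basisState`, `cnotOn_mulVec_basisState` (`|w⟩ ↦ |w[j ↦ w_j ⊕ w_i]⟩`),
  `hOn_mulVec_basisState'`;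
* the bookkeeping predicate `ActsAs M π φ` (`M|w⟩ = ω^{φ w}|π w⟩`) for words over
  `S, T, CNOT`, and the `{CNOT, T, T† = S³T}` word `cczWord` for the doubly-controlled `Z`
  gate, `cczWord_mulVec_basisState : CCZ|w⟩ = (−1)^{w_a w_b w_c}|w⟩` (phase polynomial
  `a + b + c − (a⊕b) − (b⊕c) − (a⊕c) + (a⊕b⊕c) = 4abc`);
* `hConj_mulVec_basisState`: conjugating a `±1`-diagonal gate by a Hadamard gate on wire `i`
  gives a classical gate; whence `X = H S S H` (`xWord_mulVec_basisState`, Nielsen–Chuang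
  Ex. 4.18: `HZH = X`) and Toffoli `= H_c · CCZ · H_c` (`toffoliWord_mulVec_basisState`,
  Nielsen–Chuang §4.3, Fig. 4.9 and Ex. 4.24: the Toffoli gate from Hadamard, phase, CNOT and
  `π/8` gates);
* `RevOp N` (NOT / CNOT / Toffoli on `N` wires), its classical semantics `RevOp.eval`,
  `revEval`, the compiler `RevOp.compile`, `revCompile` and the theorem
  `revCompile_mulVec_basisState : (revCompile ops)|w⟩ = |revEval ops w⟩` (Arora–Barak 2009,
  Lemma 10.10, first half of the proof), with `revCompile_isOracleFree` and the size bound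
  `length_revCompile_le` (`≤ 24` gates per operation).

## References

* M. A. Nielsen, I. L. Chuang, *Quantum Computation and Quantum Information*, CUP 2010,
  §4.2 (`S`, `T` gates; Ex. 4.18 `HZH = X`), §4.3, Fig. 4.9 (p. 182) and Ex. 4.24 (Toffoli from
  `H`, `S`, CNOT, `T`), §3.2.5 (reversible classical computation, Toffoli gate).
* S. Arora, B. Barak, *Computational Complexity: A Modern Approach*, CUP 2009, §10.3.7,
  Lemma 10.10 (Boolean circuits as a subcase of quantum circuits), Cor. 10.11 (`BPP ⊆ BQP`).
* E. Bernstein, U. Vazirani, *Quantum complexity theory*, SIAM J. Comput. 26 (1997), Thm. 8.3.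

## Design notes

* The Toffoli word used is `H_c · CCZ(a,b,c) · H_c` with the 7-`T` phase-polynomial word for
  CCZ (all wires restored), a rearrangement of Nielsen–Chuang's Fig. 4.9 that makes the
  correctness proof a computation with phases in `ℤ/8` (`ActsAs`) followed by one Hadamard
  conjugation (`hConj_mulVec_basisState`); `T†` is spelled `S S S T` (`= T⁷`). Gate counts are
  irrelevant downstream (only polynomial size matters).
* All statements are for an arbitrary oracle `A` (`QGate.toMatrix A`); the gates are
  oracle-free, so this covers `QCircuit.mat = toMatrix 0`.
-/

noncomputable section

namespace Literature.Computability.QuantumComplexity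

open _root_.Computability Complexity Cryptography Matrix

variable {N : ℕ}

/-! ### The eighth root of unity `ω = e^{iπ/4}` -/

/-- `ω = e^{iπ/4}`, the phase of the `T` gate. [Nielsen–Chuang 2010, §4.2]
[cite: NielsenChuang2010, §4.2] -/
abbrev omega : ℂ := Complex.exp (Real.pi / 4 * Complex.I)

/-- `ωⁿ = e^{inπ/4}`. [folklore] -/
theorem omega_pow (n : ℕ) : omega ^ n = Complex.exp ((n : ℂ) * (Real.pi / 4 * Complex.I)) := by
  rw [Complex.exp_nat_mul]

/-- `ω² = i`. [folklore] -/
theorem omega_pow_two : omega ^ 2 = Complex.I := by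
  rw [omega_pow]
  convert Complex.exp_pi_div_two_mul_I using 2
  push_cast; ring

/-- `ω⁴ = −1`. [folklore] -/
theorem omega_pow_four : omega ^ 4 = -1 := by
  rw [omega_pow]
  convert Complex.exp_pi_mul_I using 2
  push_cast; ring

/-- `ω⁸ = 1`. [folklore] -/
theorem omega_pow_eight : omega ^ 8 = 1 := by
  rw [omega_pow]
  convert Complex.exp_two_pi_mul_I using 2
  push_cast; ring

/-- Exponents of `ω` only matter modulo `8`. [folklore] -/
theorem omega_pow_mod_eight (n : ℕ) : omega ^ (n % 8) = omega ^ n := by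
  conv_rhs => rw [← Nat.mod_add_div n 8, pow_add, pow_mul, omega_pow_eight, one_pow, mul_one]

/-! ### Matrices on basis states -/

/-- `M |w⟩` is the `w`-th column of `M`. [folklore] -/
theorem mulVec_basisState (M : Matrix (QReg N) (QReg N) ℂ) (w : QReg N) :
    M *ᵥ basisState w = fun x => M x w := by
  ext x
  simp [basisState]


/-! ### Placed Clifford+T gates -/

/-- The `T` gate of Clifford+T placed on wire `i`. [Nielsen–Chuang 2010, §4.2] [folklore] -/
def tOn (i : Fin N) : QGate cliffordT N :=
  QGate.gate CliffordTOp.T (wireEmb i)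

/-- The phase gate `S` of Clifford+T placed on wire `i`. [Nielsen–Chuang 2010, §4.2] [folklore] -/
def sOn (i : Fin N) : QGate cliffordT N :=
  QGate.gate CliffordTOp.S (wireEmb i)

/-- The embedding `Fin 2 ↪ Fin N` selecting the two distinct wires `i` (as wire `0`) and `j`
(as wire `1`). [folklore] -/
def pairEmb (i j : Fin N) (h : i ≠ j) : Fin 2 ↪ Fin N :=
  ⟨![i, j], by
    intro a b hab
    fin_cases a <;> fin_cases b <;> simp_all [h.symm]⟩

/-- `pairEmb i j h 0 = i`. [folklore] -/
@[simp] theorem pairEmb_zero (i j : Fin N) (h : i ≠ j) : pairEmb i j h 0 = i := rfl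

/-- `pairEmb i j h 1 = j`. [folklore] -/
@[simp] theorem pairEmb_one (i j : Fin N) (h : i ≠ j) : pairEmb i j h 1 = j := rfl

/-- The range of `pairEmb i j h` is `{i, j}`. [folklore] -/
theorem range_pairEmb (i j : Fin N) (h : i ≠ j) : Set.range (pairEmb i j h) = {i, j} := by
  ext l
  simp only [Set.mem_range, Set.mem_insert_iff, Set.mem_singleton_iff]
  constructor
  · rintro ⟨a, rfl⟩
    fin_cases a <;> simp
  · rintro (rfl | rfl)
    · exact ⟨0, rfl⟩
    · exact ⟨1, rfl⟩

/-- The `CNOT` gate of Clifford+T with control wire `i` and target wire `j ≠ i`. [folklore] -/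
def cnotOn (i j : Fin N) (h : i ≠ j) : QGate cliffordT N :=
  QGate.gate CliffordTOp.CNOT (pairEmb i j h)

/-- `tOn i` is oracle-free. [folklore] -/
theorem tOn_isOracleFree (i : Fin N) : (tOn i).IsOracleFree := trivial

/-- `sOn i` is oracle-free. [folklore] -/
theorem sOn_isOracleFree (i : Fin N) : (sOn i).IsOracleFree := trivial

/-- `cnotOn i j h` is oracle-free. [folklore] -/
theorem cnotOn_isOracleFree (i j : Fin N) (h : i ≠ j) : (cnotOn i j h).IsOracleFree := trivial

/-- The matrix of `tOn i` is the placement of `tGate` on wire `i`. [folklore] -/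
theorem tOn_toMatrix (A : Language Bool) (i : Fin N) :
    (tOn i).toMatrix A = placeGate (wireEmb i) tGate := rfl

/-- The matrix of `sOn i` is the placement of `sGate` on wire `i`. [folklore] -/
theorem sOn_toMatrix (A : Language Bool) (i : Fin N) :
    (sOn i).toMatrix A = placeGate (wireEmb i) sGate := rfl

/-- The matrix of `cnotOn i j h` is the placement of `cnot` on the wires `i, j`. [folklore] -/
theorem cnotOn_toMatrix (A : Language Bool) (i j : Fin N) (h : i ≠ j) :
    (cnotOn i j h).toMatrix A = placeGate (pairEmb i j h) cnot := rfl

/-! ### One-wire gates on basis states -/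

/-- A one-qubit gate `U` placed on wire `i` maps `|w⟩` to
`U₀,_{w i} |w[i↦0]⟩ + U₁,_{w i} |w[i↦1]⟩`. [Nielsen–Chuang 2010, §4.2] [folklore] -/
theorem placeGate_wireEmb_mulVec_basisState (i : Fin N) (U : Matrix (QReg 1) (QReg 1) ℂ)
    (w : QReg N) :
    placeGate (wireEmb i) U *ᵥ basisState w =
      U (fun _ => false) (fun _ => w i) • basisState (Function.update w i false) +
        U (fun _ => true) (fun _ => w i) • basisState (Function.update w i true) := by
  ext x
  rw [mulVec_basisState]
  simp only [Pi.add_apply, Pi.smul_apply, basisState_apply, smul_eq_mul, mul_ite, mul_one,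
    mul_zero, placeGate_apply, range_wireEmb, Set.mem_singleton_iff]
  have hxe : x ∘ wireEmb i = fun _ => x i := funext fun _ => by simp
  have hwe : w ∘ wireEmb i = fun _ => w i := funext fun _ => by simp
  rw [hxe, hwe]
  by_cases hagree : ∀ l, ¬l = i → x l = w l
  · rw [if_pos hagree]
    have hx : x = Function.update w i (x i) := Function.eq_update_iff.2 ⟨rfl, hagree⟩
    cases hxi : x i
    · rw [hxi] at hx
      have hne : x ≠ Function.update w i true := fun h' => by
        have := congrFun h' i; simp [hxi] at this
      rw [if_pos hx, if_neg hne, add_zero]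
    · rw [hxi] at hx
      have hne : x ≠ Function.update w i false := fun h' => by
        have := congrFun h' i; simp [hxi] at this
      rw [if_neg hne, if_pos hx, zero_add]
  · rw [if_neg hagree]
    have hne : ∀ b, x ≠ Function.update w i b := fun b h' =>
      hagree fun l hl => by rw [h', Function.update_of_ne hl]
    rw [if_neg (hne false), if_neg (hne true), add_zero]

/-- The `T` gate on wire `i` multiplies `|w⟩` by `ω^{w i}`. [Nielsen–Chuang 2010, §4.2]
[cite: NielsenChuang2010, §4.2] -/
theorem tOn_mulVec_basisState (A : Language Bool) (i : Fin N) (w : QReg N) :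
    (tOn i).toMatrix A *ᵥ basisState w = (if w i then omega else 1) • basisState w := by
  rw [tOn_toMatrix, placeGate_wireEmb_mulVec_basisState]
  cases hw : w i
  · have h1 : Function.update w i false = w := by rw [← hw, Function.update_eq_self]
    simp [tGate, funext_iff, h1]
  · have h1 : Function.update w i true = w := by rw [← hw, Function.update_eq_self]
    simp [tGate, funext_iff, h1]

/-- The `S` gate on wire `i` multiplies `|w⟩` by `i^{w i}`. [Nielsen–Chuang 2010, §4.2]
[cite: NielsenChuang2010, §4.2] -/
theorem sOn_mulVec_basisState (A : Language Bool) (i : Fin N) (w : QReg N) :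
    (sOn i).toMatrix A *ᵥ basisState w = (if w i then Complex.I else 1) • basisState w := by
  rw [sOn_toMatrix, placeGate_wireEmb_mulVec_basisState]
  cases hw : w i
  · have h1 : Function.update w i false = w := by rw [← hw, Function.update_eq_self]
    simp [sGate, funext_iff, h1]
  · have h1 : Function.update w i true = w := by rw [← hw, Function.update_eq_self]
    simp [sGate, funext_iff, h1]

/-- The Hadamard gate on wire `i` maps `|w⟩` to `(|w[i↦0]⟩ + (-1)^{w i} |w[i↦1]⟩)/√2`
(general form of `hOn_mulVec_basisState`). [Nielsen–Chuang 2010, §1.3.1]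
[cite: NielsenChuang2010, §1.3.1] -/
theorem hOn_mulVec_basisState' (A : Language Bool) (i : Fin N) (w : QReg N) :
    (hOn i).toMatrix A *ᵥ basisState w =
      invSqrt2 • (basisState (Function.update w i false) +
        (if w i then (-1 : ℂ) else 1) • basisState (Function.update w i true)) := by
  rw [hOn_toMatrix, placeGate_wireEmb_mulVec_basisState]
  cases hw : w i
  · simp [hGate, invSqrt2]
  · simp [hGate, invSqrt2, smul_add]

/-! ### `CNOT` on basis states -/

/-- `CNOT` with control `i` and target `j` maps `|w⟩` to `|w[j ↦ w j ⊕ w i]⟩`.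
[Nielsen–Chuang 2010, §1.3.2] [cite: NielsenChuang2010, §1.3.2] -/
theorem cnotOn_mulVec_basisState (A : Language Bool) (i j : Fin N) (h : i ≠ j) (w : QReg N) :
    (cnotOn i j h).toMatrix A *ᵥ basisState w =
      basisState (Function.update w j (w j ^^ w i)) := by
  ext x
  rw [cnotOn_toMatrix, mulVec_basisState, basisState_apply]
  dsimp only
  rw [placeGate_apply]
  have key : ((∀ l, l ∉ Set.range (pairEmb i j h) → x l = w l) ∧
      (x i = w i ∧ x j = (w j ^^ w i))) ↔ x = Function.update w j (w j ^^ w i) := by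
    rw [Function.eq_update_iff, range_pairEmb]
    simp only [Set.mem_insert_iff, Set.mem_singleton_iff, not_or]
    constructor
    · rintro ⟨h1, h2, h3⟩
      refine ⟨h3, fun l hl => ?_⟩
      by_cases hli : l = i
      · subst hli; exact h2
      · exact h1 l ⟨hli, hl⟩
    · rintro ⟨h3, h1⟩
      exact ⟨fun l hl => h1 l hl.2, h1 i h, h3⟩
  simp only [cnot, Matrix.of_apply, Function.comp_apply, pairEmb_zero, pairEmb_one]
  by_cases h1 : ∀ l, l ∉ Set.range (pairEmb i j h) → x l = w l
  · rw [if_pos h1]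
    by_cases h2 : x i = w i ∧ x j = (w j ^^ w i)
    · rw [if_pos h2, if_pos (key.1 ⟨h1, h2⟩)]
    · rw [if_neg h2, if_neg (fun h' => h2 (key.2 h').2)]
  · rw [if_neg h1, if_neg (fun h' => h1 (key.2 h').1)]


/-! ### Phase-permutation bookkeeping for words over `S`, `T`, `CNOT` -/

/-- `ActsAs M π φ`: the matrix `M` maps every basis state `|w⟩` to `ω^{φ w} |π w⟩`
(a monomial matrix with eighth-root-of-unity phases, as generated by `S`, `T`, `CNOT`, `X`).
[folklore] -/
def ActsAs (M : Matrix (QReg N) (QReg N) ℂ) (π : QReg N → QReg N) (φ : QReg N → ℕ) : Prop :=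
  ∀ w, M *ᵥ basisState w = omega ^ φ w • basisState (π w)

/-- The empty circuit acts as the identity with no phase. [folklore] -/
theorem actsAs_nil (A : Language Bool) :
    ActsAs ((⟨[]⟩ : QCircuit cliffordT N).toMatrix A) id (fun _ => 0) := by
  intro w
  simp

/-- Prepending a gate composes the permutations and adds the phases. [folklore] -/
theorem ActsAs.cons {A : Language Bool} {g : QGate cliffordT N} {gs : List (QGate cliffordT N)}
    {π₁ π₂ : QReg N → QReg N} {φ₁ φ₂ : QReg N → ℕ} (hg : ActsAs (g.toMatrix A) π₁ φ₁)
    (hgs : ActsAs ((⟨gs⟩ : QCircuit cliffordT N).toMatrix A) π₂ φ₂) :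
    ActsAs ((⟨g :: gs⟩ : QCircuit cliffordT N).toMatrix A) (π₂ ∘ π₁)
      (fun w => φ₁ w + φ₂ (π₁ w)) := by
  intro w
  rw [QCircuit.toMatrix_cons, ← Matrix.mulVec_mulVec, hg w, Matrix.mulVec_smul, hgs (π₁ w),
    smul_smul, ← pow_add]
  rfl

/-- `T` on wire `i`: identity permutation, phase exponent `[w i]`. [folklore] -/
theorem actsAs_tOn (A : Language Bool) (i : Fin N) :
    ActsAs ((tOn i).toMatrix A) id (fun w => if w i then 1 else 0) := by
  intro w
  rw [tOn_mulVec_basisState]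
  by_cases hw : w i = true <;> simp [hw]

/-- `S` on wire `i`: identity permutation, phase exponent `2[w i]`. [folklore] -/
theorem actsAs_sOn (A : Language Bool) (i : Fin N) :
    ActsAs ((sOn i).toMatrix A) id (fun w => if w i then 2 else 0) := by
  intro w
  rw [sOn_mulVec_basisState]
  by_cases hw : w i = true <;> simp [hw, omega_pow_two]

/-- `CNOT`: the permutation `w ↦ w[j ↦ w j ⊕ w i]`, no phase. [folklore] -/
theorem actsAs_cnotOn (A : Language Bool) (i j : Fin N) (h : i ≠ j) :
    ActsAs ((cnotOn i j h).toMatrix A) (fun w => Function.update w j (w j ^^ w i)) (fun _ => 0) := by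
  intro w
  rw [cnotOn_mulVec_basisState]
  simp

/-- From `ActsAs` with trivial permutation and phases in `{0, 4} mod 8` to a `±1` diagonal
action. [folklore] -/
theorem ActsAs.sign {M : Matrix (QReg N) (QReg N) ℂ} {π : QReg N → QReg N} {φ : QReg N → ℕ}
    (h : ActsAs M π φ) (f : QReg N → Bool) (hπ : ∀ w, π w = w)
    (hφ : ∀ w, φ w % 8 = if f w then 4 else 0) (w : QReg N) :
    M *ᵥ basisState w = (if f w then (-1 : ℂ) else 1) • basisState w := by
  rw [h w, hπ w, ← omega_pow_mod_eight, hφ w]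
  cases f w <;> simp [omega_pow_four]

/-! ### The doubly-controlled `Z` as a `{CNOT, T, T†}` word -/

section ccz

variable (a b c : Fin N) (hab : a ≠ b) (hac : a ≠ c) (hbc : b ≠ c)

/-- The standard `{CNOT, T, T† = S³T}` word for the doubly-controlled `Z` gate on the distinct
wires `a, b, c` (7 `T`-type gates, 6 `CNOT`s): it applies the phase
`ω^{a + b + c − (a⊕b) − (b⊕c) − (a⊕c) + (a⊕b⊕c)} = ω^{4abc} = (−1)^{abc}` and restores all wires
(a rearrangement of the `T`/CNOT part of Nielsen–Chuang's Fig. 4.9).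
[Nielsen–Chuang 2010, §4.3, Fig. 4.9] [cite: NielsenChuang2010, §4.3 Fig. 4.9] -/
def cczWord : List (QGate cliffordT N) :=
  [tOn a, tOn b, tOn c,
   cnotOn a b hab, sOn b, sOn b, sOn b, tOn b,
   cnotOn b c hbc, tOn c,
   cnotOn a c hac, sOn c, sOn c, sOn c, tOn c,
   cnotOn b c hbc, sOn c, sOn c, sOn c, tOn c,
   cnotOn a c hac, cnotOn a b hab]

/-- All gates of `cczWord` are oracle-free. [folklore] -/
theorem cczWord_isOracleFree : ∀ g ∈ cczWord a b c hab hac hbc, g.IsOracleFree := by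
  intro g hg
  simp only [cczWord, List.mem_cons, List.not_mem_nil, or_false] at hg
  rcases hg with h | h | h | h | h | h | h | h | h | h | h | h | h | h | h | h | h | h | h | h | h | h <;>
    subst h <;> trivial

include hab hac hbc in
/-- **The CCZ word acts as `(−1)^{abc}`** on basis states (all wires restored).
[Nielsen–Chuang 2010, §4.3, Fig. 4.9 and Ex. 4.24] [cite: NielsenChuang2010, §4.3 Fig. 4.9] -/
theorem cczWord_mulVec_basisState (A : Language Bool) (w : QReg N) :
    (⟨cczWord a b c hab hac hbc⟩ : QCircuit cliffordT N).toMatrix A *ᵥ basisState w =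
      (if (w a && w b && w c) then (-1 : ℂ) else 1) • basisState w := by
  have H : ActsAs ((⟨cczWord a b c hab hac hbc⟩ : QCircuit cliffordT N).toMatrix A) _ _ :=
    (actsAs_tOn A a).cons <| (actsAs_tOn A b).cons <| (actsAs_tOn A c).cons <|
    (actsAs_cnotOn A a b hab).cons <| (actsAs_sOn A b).cons <| (actsAs_sOn A b).cons <|
      (actsAs_sOn A b).cons <| (actsAs_tOn A b).cons <|
    (actsAs_cnotOn A b c hbc).cons <| (actsAs_tOn A c).cons <|
    (actsAs_cnotOn A a c hac).cons <| (actsAs_sOn A c).cons <| (actsAs_sOn A c).cons <|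
      (actsAs_sOn A c).cons <| (actsAs_tOn A c).cons <|
    (actsAs_cnotOn A b c hbc).cons <| (actsAs_sOn A c).cons <| (actsAs_sOn A c).cons <|
      (actsAs_sOn A c).cons <| (actsAs_tOn A c).cons <|
    (actsAs_cnotOn A a c hac).cons <| (actsAs_cnotOn A a b hab).cons <| actsAs_nil A
  refine H.sign (fun w => w a && w b && w c) (fun w => ?_) (fun w => ?_) w
  · funext l
    simp only [Function.comp_apply, id_eq]
    rcases Bool.eq_false_or_eq_true (w a) with ha | ha <;>
    rcases Bool.eq_false_or_eq_true (w b) with hb | hb <;>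
    rcases Bool.eq_false_or_eq_true (w c) with hc | hc <;>
    · by_cases hla : l = a
      · rw [hla]
        simp [hab, hac, hbc, hbc.symm, ha, hb, hc]
      by_cases hlb : l = b
      · rw [hlb]
        simp [hab, hac, hbc, hbc.symm, ha, hb, hc]
      by_cases hlc : l = c
      · rw [hlc]
        simp [hab, hac, hbc, hbc.symm, ha, hb, hc]
      simp [hlb, hlc]
  · simp only [id_eq]
    rcases Bool.eq_false_or_eq_true (w a) with ha | ha <;>
    rcases Bool.eq_false_or_eq_true (w b) with hb | hb <;>
    rcases Bool.eq_false_or_eq_true (w c) with hc | hc <;>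
    simp [hab, hac, hbc, hbc.symm, ha, hb, hc]

end ccz


/-! ### Conjugation by a Hadamard gate -/

/-- `(√2)² = 2` in `ℂ`. [folklore] -/
theorem sqrt2_sq : ((Real.sqrt 2 : ℝ) : ℂ) ^ 2 = 2 := by
  rw [← Complex.ofReal_pow, Real.sq_sqrt (by norm_num : (0 : ℝ) ≤ 2)]
  norm_num

/-- `(1/√2)² = 1/2`. [folklore] -/
theorem invSqrt2_mul_invSqrt2 : invSqrt2 * invSqrt2 = 1 / 2 := by
  simp only [invSqrt2]
  rw [div_mul_div_comm, one_mul, ← sq, sqrt2_sq]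

/-- `H² = 1` for the one-qubit Hadamard matrix. [Nielsen–Chuang 2010, §1.3.1 and Ex. 2.52]
[cite: NielsenChuang2010, §1.3.1] -/
theorem hGate_mul_hGate : hGate * hGate = (1 : Matrix (QReg 1) (QReg 1) ℂ) := by
  ext x y
  rw [Matrix.mul_apply, Fintype.sum_equiv (Equiv.funUnique (Fin 1) Bool) _
    (fun b => hGate x (fun _ => b) * hGate (fun _ => b) y) (fun z => by
      have hz : z = fun _ => z 0 := funext fun k => by rw [Subsingleton.elim k 0]
      simp only [Equiv.funUnique_apply]
      exact congrArg₂ (fun u v => hGate x u * hGate v y) hz hz)]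
  rw [Fintype.sum_bool, Matrix.one_apply]
  have hxy : x = y ↔ x 0 = y 0 :=
    ⟨fun h => by rw [h], fun h => funext fun k => by rw [Subsingleton.elim k 0, h]⟩
  simp only [hGate, Matrix.of_apply, and_true, hxy]
  have hs : ((Real.sqrt 2 : ℝ) : ℂ)⁻¹ * ((Real.sqrt 2 : ℝ) : ℂ)⁻¹ = 1 / 2 := by
    simpa [invSqrt2, one_div] using invSqrt2_mul_invSqrt2
  rcases Bool.eq_false_or_eq_true (x 0) with hx | hx <;>
  rcases Bool.eq_false_or_eq_true (y 0) with hy | hy <;>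
  simp [hx, hy] <;> rw [hs] <;> norm_num

/-- `H² = 1` for the Hadamard gate placed on a wire. [Nielsen–Chuang 2010, §1.3.1]
[cite: NielsenChuang2010, §1.3.1] -/
theorem hOn_mul_hOn (A : Language Bool) (i : Fin N) :
    (hOn i).toMatrix A * (hOn i).toMatrix A = 1 := by
  rw [hOn_toMatrix, ← placeGate_mul_holds, hGate_mul_hGate, placeGate_one]

/-- **Hadamard conjugation of a `±1` phase.** If `D|w⟩ = (−1)^{f w}|w⟩` for all `w`, then
`H_i D H_i` acts classically: it maps `|w⟩` to
`(−1)^{f(w[i↦0])} |w[i ↦ w i ⊕ f(w[i↦0]) ⊕ f(w[i↦1])]⟩`. (With `D = Z_i`: `HZH = X`; with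
`D = CCZ`: the Toffoli gate.) [Nielsen–Chuang 2010, Ex. 4.18 (`HZH = X`) and §4.3, Fig. 4.9]
[cite: NielsenChuang2010, §4.3 Fig. 4.9] -/
theorem hConj_mulVec_basisState (A : Language Bool) (i : Fin N) {D : Matrix (QReg N) (QReg N) ℂ}
    {f : QReg N → Bool}
    (hD : ∀ w, D *ᵥ basisState w = (if f w then (-1 : ℂ) else 1) • basisState w) (w : QReg N) :
    (hOn i).toMatrix A *ᵥ (D *ᵥ ((hOn i).toMatrix A *ᵥ basisState w)) =
      (if f (Function.update w i false) then (-1 : ℂ) else 1) •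
        basisState (Function.update w i
          (w i ^^ (f (Function.update w i false) ^^ f (Function.update w i true)))) := by
  set w0 := Function.update w i false with hw0
  set w1 := Function.update w i true with hw1
  set w' := Function.update w i (w i ^^ (f w0 ^^ f w1)) with hw'
  have h0 : Function.update w' i false = w0 := by simp [w', w0]
  have h1 : Function.update w' i true = w1 := by simp [w', w1]
  have hw'i : w' i = (w i ^^ (f w0 ^^ f w1)) := by simp [w']
  have hHH : basisState w' = (hOn i).toMatrix A *ᵥ ((hOn i).toMatrix A *ᵥ basisState w') := by
    rw [Matrix.mulVec_mulVec, hOn_mul_hOn, Matrix.one_mulVec]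
  rw [hHH, hOn_mulVec_basisState' A i w', h0, h1, hw'i, ← Matrix.mulVec_smul]
  congr 1
  rw [hOn_mulVec_basisState' A i w, Matrix.mulVec_smul, Matrix.mulVec_add, Matrix.mulVec_smul,
    ← hw0, ← hw1, hD, hD]
  rcases Bool.eq_false_or_eq_true (w i) with hi | hi <;>
  rcases Bool.eq_false_or_eq_true (f w0) with hf0 | hf0 <;>
  rcases Bool.eq_false_or_eq_true (f w1) with hf1 | hf1 <;>
  · simp only [hi, hf0, hf1, if_true, if_false, Bool.false_eq_true, Bool.not_true,
      Bool.not_false, Bool.bne_true, Bool.bne_false]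
    ext z
    simp only [Pi.smul_apply, Pi.add_apply, smul_eq_mul]
    ring

/-- Semantics of a word of the form `H_i · mid · H_i`. [folklore] -/
theorem hSandwich_mulVec (A : Language Bool) (i : Fin N) (mid : List (QGate cliffordT N))
    (v : QReg N → ℂ) :
    (⟨hOn i :: (mid ++ [hOn i])⟩ : QCircuit cliffordT N).toMatrix A *ᵥ v =
      (hOn i).toMatrix A *ᵥ ((⟨mid⟩ : QCircuit cliffordT N).toMatrix A *ᵥ
        ((hOn i).toMatrix A *ᵥ v)) := by
  rw [QCircuit.toMatrix_cons, show (⟨mid ++ [hOn i]⟩ : QCircuit cliffordT N) =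
    (⟨mid⟩ : QCircuit cliffordT N).append ⟨[hOn i]⟩ from rfl, QCircuit.toMatrix_append,
    QCircuit.toMatrix_cons, QCircuit.toMatrix_nil, Matrix.one_mul, Matrix.mulVec_mulVec,
    Matrix.mulVec_mulVec]

/-! ### The `X` gate as `H S S H` -/

/-- The word `H S S H` on wire `i` (`S² = Z`, `HZH = X`). [Nielsen–Chuang 2010, §4.2,
Ex. 4.18] [cite: NielsenChuang2010, §4.2 Ex. 4.18] -/
def xWord (i : Fin N) : List (QGate cliffordT N) :=
  [hOn i, sOn i, sOn i, hOn i]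

/-- `xWord i` is oracle-free. [folklore] -/
theorem xWord_isOracleFree (i : Fin N) : ∀ g ∈ xWord i, g.IsOracleFree := by
  intro g hg
  simp only [xWord, List.mem_cons, List.not_mem_nil, or_false] at hg
  rcases hg with h | h | h | h <;> subst h <;> trivial

/-- `S S` on wire `i` acts as `Z_i`: `|w⟩ ↦ (−1)^{w i}|w⟩` (`S² = Z`). [Nielsen–Chuang 2010,
§4.2] [cite: NielsenChuang2010, §4.2] -/
theorem ss_mulVec_basisState (A : Language Bool) (i : Fin N) (w : QReg N) :
    (⟨[sOn i, sOn i]⟩ : QCircuit cliffordT N).toMatrix A *ᵥ basisState w =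
      (if w i then (-1 : ℂ) else 1) • basisState w := by
  have H : ActsAs ((⟨[sOn i, sOn i]⟩ : QCircuit cliffordT N).toMatrix A) _ _ :=
    (actsAs_sOn A i).cons <| (actsAs_sOn A i).cons <| actsAs_nil A
  refine H.sign (fun w => w i) (fun w => rfl) (fun w => ?_) w
  by_cases hw : w i = true <;> simp [hw]

/-- **`X = H S S H` on basis states**: the word flips wire `i`. [Nielsen–Chuang 2010, §4.2,
Ex. 4.18 (`HZH = X`)] [cite: NielsenChuang2010, §4.2 Ex. 4.18] -/
theorem xWord_mulVec_basisState (A : Language Bool) (i : Fin N) (w : QReg N) :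
    (⟨xWord i⟩ : QCircuit cliffordT N).toMatrix A *ᵥ basisState w =
      basisState (Function.update w i (!w i)) := by
  rw [show xWord i = hOn i :: ([sOn i, sOn i] ++ [hOn i]) from rfl, hSandwich_mulVec,
    hConj_mulVec_basisState A i (ss_mulVec_basisState A i) w]
  simp

/-! ### The Toffoli gate as `H · CCZ · H` -/

section toffoli

variable (a b c : Fin N) (hab : a ≠ b) (hac : a ≠ c) (hbc : b ≠ c)

/-- The Clifford+T word for the Toffoli gate with controls `a, b` and target `c`:
`H_c · CCZ(a,b,c) · H_c`. [Nielsen–Chuang 2010, §4.3, Fig. 4.9 (p. 182) and Ex. 4.24]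
[cite: NielsenChuang2010, §4.3 Fig. 4.9] -/
def toffoliWord : List (QGate cliffordT N) :=
  hOn c :: (cczWord a b c hab hac hbc ++ [hOn c])

/-- `toffoliWord` is oracle-free. [folklore] -/
theorem toffoliWord_isOracleFree : ∀ g ∈ toffoliWord a b c hab hac hbc, g.IsOracleFree := by
  intro g hg
  simp only [toffoliWord, List.mem_cons, List.mem_append, List.not_mem_nil, or_false] at hg
  rcases hg with h | h | h
  · subst h; trivial
  · exact cczWord_isOracleFree a b c hab hac hbc g h
  · subst h; trivial

include hab hac hbc in
/-- **The Toffoli word on basis states**: `|w⟩ ↦ |w[c ↦ w c ⊕ (w a ∧ w b)]⟩`, i.e. the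
compiled word is exactly the Toffoli gate `|abc⟩ ↦ |ab(c ⊕ ab)⟩` on the computational basis.
[Nielsen–Chuang 2010, §4.3, Fig. 4.9 (p. 182) and Ex. 4.24; Arora–Barak 2009, §10.3.3]
[cite: NielsenChuang2010, §4.3 Fig. 4.9] -/
theorem toffoliWord_mulVec_basisState (A : Language Bool) (w : QReg N) :
    (⟨toffoliWord a b c hab hac hbc⟩ : QCircuit cliffordT N).toMatrix A *ᵥ basisState w =
      basisState (Function.update w c (w c ^^ (w a && w b))) := by
  rw [toffoliWord, hSandwich_mulVec,
    hConj_mulVec_basisState A c (cczWord_mulVec_basisState a b c hab hac hbc A) w]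
  simp [hac, hbc]

end toffoli


/-! ### Reversible classical circuits over `{X, CNOT, Toffoli}` compiled into Clifford+T -/

/-- The classical reversible operations on `N` wires: `NOT` on a wire, `CNOT` (target
`j ← j ⊕ i`) and Toffoli (target `c ← c ⊕ ab`) on distinct wires. [Nielsen–Chuang 2010,
§3.2.5 (reversible classical computation with Toffoli gates); Arora–Barak 2009, §10.3.7,
Lemma 10.10] [cite: AroraBarak2009, §10.3.7 Lemma 10.10] -/
inductive RevOp (N : ℕ)
  /-- `NOT` on wire `i`. -/
  | not (i : Fin N)
  /-- `CNOT` with control `i` and target `j`. -/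
  | cnot (i j : Fin N) (h : i ≠ j)
  /-- Toffoli with controls `a, b` and target `c`. -/
  | toffoli (a b c : Fin N) (hab : a ≠ b) (hac : a ≠ c) (hbc : b ≠ c)

namespace RevOp

/-- The classical semantics of a reversible operation on bit strings. [Nielsen–Chuang 2010,
§3.2.5] [cite: NielsenChuang2010, §3.2.5] -/
def eval : RevOp N → QReg N → QReg N
  | not i, w => Function.update w i (!w i)
  | cnot i j _, w => Function.update w j (w j ^^ w i)
  | toffoli a b c _ _ _, w => Function.update w c (w c ^^ (w a && w b))

/-- Compilation of a reversible operation into a Clifford+T word (`X = HSSH`, `CNOT`,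
Toffoli = `H · CCZ · H`). [Nielsen–Chuang 2010, §4.3, Fig. 4.9; Arora–Barak 2009,
Lemma 10.10] [cite: AroraBarak2009, §10.3.7 Lemma 10.10] -/
def compile : RevOp N → List (QGate cliffordT N)
  | not i => xWord i
  | cnot i j h => [cnotOn i j h]
  | toffoli a b c hab hac hbc => toffoliWord a b c hab hac hbc

/-- Compiled words are oracle-free. [folklore] -/
theorem compile_isOracleFree (op : RevOp N) : ∀ g ∈ op.compile, g.IsOracleFree := by
  cases op with
  | not i => exact xWord_isOracleFree i
  | cnot i j h =>
    intro g hg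
    simp only [compile, List.mem_singleton] at hg
    subst hg; trivial
  | toffoli a b c hab hac hbc => exact toffoliWord_isOracleFree a b c hab hac hbc

/-- **A compiled reversible operation acts classically on basis states.**
[Nielsen–Chuang 2010, §4.3; Arora–Barak 2009, Lemma 10.10] [cite: AroraBarak2009, §10.3.7 Lemma 10.10] -/
theorem compile_mulVec_basisState (A : Language Bool) (op : RevOp N) (w : QReg N) :
    (⟨op.compile⟩ : QCircuit cliffordT N).toMatrix A *ᵥ basisState w = basisState (op.eval w) := by
  cases op with
  | not i => exact xWord_mulVec_basisState A i w
  | cnot i j h =>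
    rw [compile, QCircuit.toMatrix_cons, QCircuit.toMatrix_nil, Matrix.one_mul,
      cnotOn_mulVec_basisState]
    rfl
  | toffoli a b c hab hac hbc => exact toffoliWord_mulVec_basisState a b c hab hac hbc A w

end RevOp

/-- The classical semantics of a reversible circuit (a list of operations, head first).
[Nielsen–Chuang 2010, §3.2.5] [cite: NielsenChuang2010, §3.2.5] -/
def revEval : List (RevOp N) → QReg N → QReg N
  | [], w => w
  | op :: ops, w => revEval ops (op.eval w)

/-- `revEval` of a concatenation. [folklore] -/
theorem revEval_append (ops ops' : List (RevOp N)) (w : QReg N) :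
    revEval (ops ++ ops') w = revEval ops' (revEval ops w) := by
  induction ops generalizing w with
  | nil => rfl
  | cons op ops ih => exact ih _

/-- Compilation of a reversible circuit into Clifford+T, operation by operation.
[Arora–Barak 2009, §10.3.7, Lemma 10.10] [cite: AroraBarak2009, §10.3.7 Lemma 10.10] -/
def revCompile (ops : List (RevOp N)) : List (QGate cliffordT N) :=
  ops.flatMap RevOp.compile

/-- `revCompile` of a cons. [folklore] -/
theorem revCompile_cons (op : RevOp N) (ops : List (RevOp N)) :
    revCompile (op :: ops) = op.compile ++ revCompile ops := rfl

/-- `revCompile` of a concatenation. [folklore] -/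
theorem revCompile_append (ops ops' : List (RevOp N)) :
    revCompile (ops ++ ops') = revCompile ops ++ revCompile ops' := by
  simp [revCompile]

/-- Compiled reversible circuits are oracle-free. [folklore] -/
theorem revCompile_isOracleFree (ops : List (RevOp N)) :
    (⟨revCompile ops⟩ : QCircuit cliffordT N).IsOracleFree := by
  intro g hg
  simp only [revCompile, List.mem_flatMap] at hg
  obtain ⟨op, -, hg⟩ := hg
  exact op.compile_isOracleFree g hg

/-- The number of Clifford+T gates of a compiled circuit is at most `24` per operation.
[folklore] -/
theorem length_revCompile_le (ops : List (RevOp N)) :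
    (revCompile ops).length ≤ 24 * ops.length := by
  induction ops with
  | nil => simp [revCompile]
  | cons op ops ih =>
    rw [revCompile_cons, List.length_append, List.length_cons]
    have : op.compile.length ≤ 24 := by
      cases op <;> simp [RevOp.compile, xWord, toffoliWord, cczWord]
    omega

/-- **Compiled reversible circuits act classically on basis states**: the Clifford+T
circuit `revCompile ops` maps `|w⟩` to `|revEval ops w⟩` ("replace each Boolean gate by its
quantum analog … the resulting computation maps `|x⟩|0…⟩ ↦ |x⟩|f(x)…⟩|z⟩`").
[Arora–Barak 2009, §10.3.7, Lemma 10.10 (proof, first half); Nielsen–Chuang 2010, §4.3]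
[cite: AroraBarak2009, §10.3.7 Lemma 10.10] -/
theorem revCompile_mulVec_basisState (A : Language Bool) (ops : List (RevOp N)) (w : QReg N) :
    (⟨revCompile ops⟩ : QCircuit cliffordT N).toMatrix A *ᵥ basisState w =
      basisState (revEval ops w) := by
  induction ops generalizing w with
  | nil => simp [revCompile, revEval]
  | cons op ops ih =>
    rw [revCompile_cons, show (⟨op.compile ++ revCompile ops⟩ : QCircuit cliffordT N) =
      (⟨op.compile⟩ : QCircuit cliffordT N).append ⟨revCompile ops⟩ from rfl,
      QCircuit.toMatrix_append, ← Matrix.mulVec_mulVec, RevOp.compile_mulVec_basisState, ih]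
    rfl

end Literature.Computability.QuantumComplexity
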